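import Literature.NumberTheory.EllipticCurves.KodairaNeronLeFourProofs
import Literature.NumberTheory.EllipticCurves.ReductionHomomorphismCuspNodeProofs
import Literature.NumberTheory.EllipticCurves.TamagawaSubgroupProofs
import Summits.BirchSwinnertonDyer.Rank1Residual.GaloisImage.LocalThreeTorsionCount
import HarnessLib

/-!
# `27·P = 0 ⇒ 9·P = 0` on `E(ℚ₃)` at ADDITIVE reduction: the `3`-power torsion of `E(ℚ₃)` has
# exponent dividing `9` — T-DER-BP's binder `hstab` discharged UNIFORMLY with `N₀ = 2`
# (cell `b2b-bsdres`, team n1011, row T-DER-BP FILE 3a; seat n1011-p13 GEN 11;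
# skeleton `cells/n1011/skel/T-DER-BP.md` STATUS v2)

HONEST FRAMING (cell `b2b-bsdres`, run/shared/lean/b2b/bsd-rank1-residual/, verbatim in every
file): the goal of the cell is to DELETE the COMBINATION-SHAPED residual classes of the
Birch–Swinnerton-Dyer formula for ALL analytic-rank `≤ 1` elliptic curves over `ℚ` — "full BSD
formula for every rank `≤ 1` curve in class `C`" assembled STRICTLY from published theorems — so
that the rank-`≤ 1` remainder becomes exactly the CONSTRUCTION-SHAPED classes, which are TYPED
(missing-input `Prop`s), NOT attempted. This is not "finishing BSD". Team n1011 (X4 ∧ `p = 3`,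
§I N11; row T-DER = Kolyvagin's derivative construction behind the route-1 PORT): research route;
TOOL theorems only; no definition, no named fact, no `sorry`; nothing booked; no mark / label / count
moved; closes nothing by itself.

## What

Row T-DER-BP (`PropagatedConditionStableRange[Three]`) makes THEOREM B at the place `3` automatic
for reduced classes of depth `m ≥ k + N₀`, where `N₀` is a `3`-power TORSION-STABILISATION level of
`E(ℚ₃)` — the displayed binder `hstab : ∀ P, 3^(N₀+1) • P = 0 → 3^N₀ • P = 0`.  This file discharges
`hstab` with `N₀ = 2` for EVERY elliptic curve over `ℚ₃` with ADDITIVE reduction (all X4 rows),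
working over Mathlib's `ℚ_[3]` / `ℤ_[3]` (the `v.adicCompletion ℚ` reading is the sibling FILE 3b):

* `LocalTorsionExp3.eq_zero_of_reducesToZero_of_three_nsmul` : **`E₁(ℚ₃)[3] = 0`** — a point of a
  `ℤ_[3]`-integral equation which reduces to `O` (`x ∉ ℤ_[3]`) and is killed by `3` is `O`
  (n1011-p17/p18's `LocalTorsion3.norm_le_one_of_three_nsmul_eq_zero`: `3`-torsion points have
  `‖x‖ ≤ 1`; Silverman *AEC* IV.3.2 / VII.3 at `e = 1`);
* `LocalTorsionExp3.eq_zero_of_reducesToZero_of_pow_nsmul` : hence **no `3`-power torsion in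
  `E₁(ℚ₃)`** (peel one factor `3` at a time inside the subgroup `E₁ = ker` of reduction);
* `LocalTorsionExp3.reducesToZero_three_nsmul_of_mem` : at ADDITIVE reduction **`3 • E₀(ℚ₃) ⊆ E₁(ℚ₃)`**
  — the reduction is a cusp, `E₀(K)/E₁(K) ↪ Ẽ_ns(k̄) ≅ (k̄, +)` (tree
  `exists_addMonoidHom_residueField_of_cusp`, *AEC* VII.2.1 + III.2.5) and `k̄ ⊇ 𝔽₃` has
  characteristic `3`;
* **`LocalTorsionExp3.nine_nsmul_eq_zero_of_hasAdditiveReduction`** : for `X/ℚ_[3]` with additive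
  reduction (Mathlib `HasAdditiveReduction ℤ_[3]`, in particular `ℤ_[3]`-minimal) and elliptic,
  **`27 • P = 0 → 9 • P = 0` for every `P ∈ X(ℚ₃)`**: with `c = [X(ℚ₃) : X₀(ℚ₃)] ∈ {1,2,3,4}`
  (Kodaira–Néron for non-split-multiplicative reduction, tree THEOREM
  `index_goodReductionSubgroup_le_four_holds`, *ATAEC* IV.9.2 (d)) one has `c • P ∈ X₀`,
  `3c • P ∈ X₁`, so `3c • P = 0` for `P` of `3`-power order, whence `9 • P = 0`
  (`c = 3`) or `3 • P = 0` (`c ∈ {1, 2, 4}`).  Stated for `ℚ_[p]` with `p = 3` (`hp3`) so that the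
  consumer can feed `p := primesEquiv v`.  Consequently the `3`-power torsion of `E(ℚ₃)` has
  exponent dividing `9` (informally `#E(ℚ₃)[3^∞] ∣ 3·(c₃)₃`, r1 GEN 34 P.S.), i.e. `N₀ ≤ 2` on every
  additive row (`= 1` unless Kodaira IV/IV* with `c₃ = 3` — that sharper `c₃`-reading is not needed
  by T-DER-BP and is not proved here).

References: J. H. Silverman, *AEC* 2nd ed. (2009) IV.3.2, VII.2.1, VII.3.1, VII.6.1
[SilvermanAEC2009]; *ATAEC* (1994) Cor. IV.9.2 (d) [SilvermanATAEC1994]; B. Mazur, K. Rubin,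
Mem. AMS 799 (2004) App. A Prop. A.2 (the consumer) [MazurRubin2004].
-/

noncomputable section

open scoped Classical
open WeierstrassCurve IsLocalRing

namespace Summit.BirchSwinnertonDyer.Rank1Residual.GaloisImage.LocalTorsionExp3

/-! ### §1. `E₁(ℚ₃)` has no `3`-power torsion -/

/-- **`E₁(ℚ₃)[3] = 0`** for a `ℤ_[3]`-integral equation: a point reducing to `O` (`x ∉ ℤ_[3]`,
i.e. `‖x‖ > 1`) with `3 • P = O` is `O`, because a `3`-torsion point has `‖x‖ ≤ 1`
(`LocalTorsion3.norm_le_one_of_three_nsmul_eq_zero`). [cite: SilvermanAEC2009, IV.3.2 and VII.3.1 (PDF pp. 120, 180)] -/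
theorem eq_zero_of_reducesToZero_of_three_nsmul (I : WeierstrassCurve ℤ_[3])
    [(I.baseChange ℚ_[3]).IsElliptic] {P : (I.baseChange ℚ_[3]).toAffine.Point}
    (hP : I.ReducesToZero P) (h3 : 3 • P = 0) : P = 0 := by
  rcases P with _ | ⟨x, y, h⟩
  · rfl
  · exfalso
    haveI : (I.baseChange ℚ_[3]).IsIntegral ℤ_[3] := ⟨⟨I, rfl⟩⟩
    have hx : ‖x‖ ≤ 1 := LocalTorsion3.norm_le_one_of_three_nsmul_eq_zero (I.baseChange ℚ_[3]) h
      (by exact_mod_cast h3)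
    have hmem : x ∈ Set.range (algebraMap ℤ_[3] ℚ_[3]) := ⟨⟨x, hx⟩, rfl⟩
    exact ((reducesToZero_some_iff (W := I) h).mp hP) hmem

/-- **No `3`-power torsion in `E₁(ℚ₃)`**: inside the kernel of reduction (a subgroup,
`kernelOfReduction`), `3^n • P = O` forces `P = O` (peel: `3^(n-1) • P ∈ E₁[3] = 0`).
[cite: SilvermanAEC2009, VII.3.1 with IV.6.1 (PDF pp. 180, 123)] -/
theorem eq_zero_of_reducesToZero_of_pow_nsmul (I : WeierstrassCurve ℤ_[3])
    [(I.baseChange ℚ_[3]).IsElliptic] (n : ℕ) :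
    ∀ {P : (I.baseChange ℚ_[3]).toAffine.Point}, I.ReducesToZero P → 3 ^ n • P = 0 → P = 0 := by
  have hv := Literature.NumberTheory.EllipticCurves.integers_valuationRing_valuation ℤ_[3] ℚ_[3]
  induction n with
  | zero => intro P _ h; simpa using h
  | succ n ih =>
    intro P hP h
    -- `3^n • P ∈ E₁` and `3 • (3^n • P) = 0`
    have hmem : 3 ^ n • P ∈ I.kernelOfReduction hv :=
      AddSubgroup.nsmul_mem _ ((mem_kernelOfReduction_iff hv).mpr hP) _
    have h3 : 3 • (3 ^ n • P) = 0 := by rw [← mul_nsmul', ← pow_succ']; exact h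
    have hzero := eq_zero_of_reducesToZero_of_three_nsmul I
      ((mem_kernelOfReduction_iff hv).mp hmem) h3
    exact ih hP hzero

/-! ### §2. Additive reduction: `3 • E₀(ℚ₃) ⊆ E₁(ℚ₃)` -/

/-- `3 = 0` in the residue field `𝔽₃` of `ℤ_[3]`. [folklore] -/
theorem three_eq_zero_residueField : (3 : ResidueField ℤ_[3]) = 0 := by
  rw [← map_ofNat (residue ℤ_[3]) 3, residue_eq_zero_iff, PadicInt.maximalIdeal_eq_span_p,
    Nat.cast_ofNat]
  exact Ideal.mem_span_singleton_self _

/-- The algebraic closure of the residue field of `ℤ_[3]` has characteristic `3`. [folklore] -/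
theorem charP_algebraicClosure_residueField :
    CharP (AlgebraicClosure (ResidueField ℤ_[3])) 3 := by
  haveI : CharP (ResidueField ℤ_[3]) 3 :=
    (CharP.charP_iff_prime_eq_zero Nat.prime_three).mpr three_eq_zero_residueField
  exact charP_of_injective_algebraMap (algebraMap (ResidueField ℤ_[3]) _).injective 3

/-- **`3 • E₀(ℚ₃) ⊆ E₁(ℚ₃)` at additive reduction**: if the reduction of the `ℤ_[3]`-equation `I`
is a cusp (`Δ̃ = c̃₄ = 0`), then for every `Q ∈ E₀(ℚ₃)` the point `3 • Q` reduces to `O` — the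
reduction homomorphism lands in `Ẽ_ns(k̄) ≅ (k̄, +)` (`exists_addMonoidHom_residueField_of_cusp`,
kernel `E₁`), a group killed by `3`. [cite: SilvermanAEC2009, VII.2 Prop. 2.1 and III.2.5 (PDF pp. 167, 56)] -/
theorem reducesToZero_three_nsmul_of_mem (I : WeierstrassCurve ℤ_[3])
    (hΔ : residue ℤ_[3] I.Δ = 0) (hc₄ : residue ℤ_[3] I.c₄ = 0)
    {Q : (I.baseChange ℚ_[3]).toAffine.Point}
    (hQ : Q ∈ I.nonsingularReductionSubgroup
      (Literature.NumberTheory.EllipticCurves.integers_valuationRing_valuation ℤ_[3] ℚ_[3])) :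
    I.ReducesToZero (3 • Q) := by
  set hv := Literature.NumberTheory.EllipticCurves.integers_valuationRing_valuation ℤ_[3] ℚ_[3]
  obtain ⟨r, hr⟩ := I.exists_addMonoidHom_residueField_of_cusp hv hΔ hc₄
  haveI := charP_algebraicClosure_residueField
  have h3 : r (3 • ⟨Q, hQ⟩) = 0 := by
    rw [map_nsmul, nsmul_eq_mul, show ((3 : ℕ) : AlgebraicClosure (ResidueField ℤ_[3])) = 0 from
      CharP.cast_eq_zero _ 3, zero_mul]
  exact (hr _).mp h3

/-! ### §3. The exponent bound at additive reduction -/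

/-- Arithmetic: `(3c) • P = 0` with `1 ≤ c ≤ 4` and `27 • P = 0` give `9 • P = 0`
(`c = 3`: verbatim; `c ∈ {1, 2, 4}`: `3 • P = 0` as `gcd(3c, 27) = 3`). [folklore] -/
theorem nine_nsmul_eq_zero_of_mul_nsmul_eq_zero {A : Type*} [AddCommGroup A] {P : A} {c : ℕ}
    (hc1 : 1 ≤ c) (hc4 : c ≤ 4) (hc : (3 * c) • P = 0) (h27 : 27 • P = 0) : 9 • P = 0 := by
  interval_cases c
  · -- `3 • P = 0`
    rw [show (9 : ℕ) = 3 * 3 from rfl, mul_nsmul', hc, nsmul_zero]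
  · -- `6 • P = 0`, `27 • P = 0` ⇒ `3 • P = 30 • P - 27 • P = 0`
    have h30 : 30 • P = 0 := by
      rw [show (30 : ℕ) = 5 * (3 * 2) from rfl, mul_nsmul', hc, nsmul_zero]
    have h3 : 3 • P = 0 := by
      have h := add_nsmul P 27 3
      rw [show 27 + 3 = 30 from rfl, h30, h27, zero_add] at h
      exact h.symm
    rw [show (9 : ℕ) = 3 * 3 from rfl, mul_nsmul', h3, nsmul_zero]
  · exact hc
  · -- `12 • P = 0`, `27 • P = 0` ⇒ `3 • P = 3 • (12 • P)·… : 3 = 36 - ... ` use `84 = 81 + 3`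
    have h84 : 84 • P = 0 := by
      rw [show (84 : ℕ) = 7 * (3 * 4) from rfl, mul_nsmul', hc, nsmul_zero]
    have h81 : 81 • P = 0 := by
      rw [show (81 : ℕ) = 3 * 27 from rfl, mul_nsmul', h27, nsmul_zero]
    have h3 : 3 • P = 0 := by
      have h := add_nsmul P 81 3
      rw [show 81 + 3 = 84 from rfl, h84, h81, zero_add] at h
      exact h.symm
    rw [show (9 : ℕ) = 3 * 3 from rfl, mul_nsmul', h3, nsmul_zero]

/-- **`27 • P = 0 → 9 • P = 0` on `X(ℚ₃)` for `X/ℚ_[3]` with ADDITIVE reduction** (stated over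
`ℚ_[p]` with `p = 3` so that consumers may take `p := primesEquiv v`): the `3`-power torsion of
`E(ℚ₃)` has exponent dividing `9`, i.e. T-DER-BP's `hstab` holds with `N₀ = 2` (module docstring:
index `≤ 4` of `E₀` by `index_goodReductionSubgroup_le_four_holds`, cusp `3 • E₀ ⊆ E₁`, and no
`3`-power torsion in `E₁`).  OURS as an assembled statement; the ingredients are *AEC* VII.6.1 /
VII.2.1 / VII.3.1 with IV.6.1 (`e = 1 < p − 1`). [cite: SilvermanATAEC1994, Cor. IV.9.2(d) with (b) (PDF p. 340)] -/
theorem nine_nsmul_eq_zero_of_hasAdditiveReduction {p : ℕ} [Fact p.Prime] (hp3 : p = 3)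
    (X : WeierstrassCurve ℚ_[p]) [X.IsElliptic] [hadd : X.HasAdditiveReduction ℤ_[p]]
    (P : X.toAffine.Point) (h27 : 3 ^ (2 + 1) • P = 0) : 3 ^ 2 • P = 0 := by
  subst hp3
  -- an integral model `I` with `X = I ⊗ ℚ₃`
  haveI : X.IsMinimal ℤ_[3] := hadd.toIsMinimal
  obtain ⟨I, hI⟩ : ∃ I : WeierstrassCurve ℤ_[3], X = I.baseChange ℚ_[3] :=
    IsIntegral.integral (R := ℤ_[3]) (W := X)
  subst hI
  have h27' : 27 • P = 0 := by norm_num at h27; exact h27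
  set hv := Literature.NumberTheory.EllipticCurves.integers_valuationRing_valuation ℤ_[3] ℚ_[3]
  -- residue field finite ⇒ perfect (hypothesis of the Kodaira–Néron bound)
  haveI : Finite (ResidueField ℤ_[3]) :=
    Finite.of_equiv (ZMod 3) (PadicInt.residueField (p := 3)).symm.toEquiv
  haveI : PerfectField (ResidueField ℤ_[3]) := PerfectField.ofFinite
  -- `c = [E(ℚ₃) : E₀(ℚ₃)] ∈ {1, …, 4}`
  have hns : ¬ (I.baseChange ℚ_[3]).HasSplitMultiplicativeReduction ℤ_[3] := fun hs =>
    hadd.not_hasMultiplicativeReduction _ hs.toHasMultiplicativeReduction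
  obtain ⟨hc0, hc4⟩ := index_goodReductionSubgroup_le_four_holds (R := ℤ_[3])
    (W := I.baseChange ℚ_[3]) hns
  set c := ((I.baseChange ℚ_[3]).goodReductionSubgroup ℤ_[3]).index with hcdef
  have hcP : c • P ∈ (I.baseChange ℚ_[3]).goodReductionSubgroup ℤ_[3] :=
    AddSubgroup.nsmul_index_mem _ P
  rw [goodReductionSubgroup_baseChange_eq] at hcP
  -- additive reduction: `Δ̃ = 0`, `c̃₄ = 0`
  have hΔm : I.Δ ∈ maximalIdeal ℤ_[3] := by
    have h := hadd.badReduction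
    rw [WeierstrassCurve.baseChange, WeierstrassCurve.map_Δ] at h
    exact (IsDedekindDomain.HeightOneSpectrum.valuation_lt_one_iff_mem _ _).mp h
  have hc₄m : I.c₄ ∈ maximalIdeal ℤ_[3] := by
    have h := hadd.additiveReduction
    rw [WeierstrassCurve.baseChange, WeierstrassCurve.map_c₄] at h
    exact (IsDedekindDomain.HeightOneSpectrum.valuation_lt_one_iff_mem _ _).mp h
  have hΔ : residue ℤ_[3] I.Δ = 0 := (residue_eq_zero_iff _).mpr hΔm
  have hc₄ : residue ℤ_[3] I.c₄ = 0 := (residue_eq_zero_iff _).mpr hc₄m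
  -- `3c • P ∈ E₁` and is killed by `27`
  have hred : I.ReducesToZero (3 • (c • P)) := reducesToZero_three_nsmul_of_mem I hΔ hc₄ hcP
  have hkill : 3 ^ 3 • (3 • (c • P)) = 0 := by
    rw [smul_comm (3 ^ 3) 3, smul_comm (3 ^ 3) c, show (3 ^ 3 : ℕ) = 27 from rfl, h27', nsmul_zero,
      nsmul_zero]
  have h3c : (3 * c) • P = 0 := by
    rw [mul_nsmul']
    exact eq_zero_of_reducesToZero_of_pow_nsmul I 3 hred hkill
  have h9 := nine_nsmul_eq_zero_of_mul_nsmul_eq_zero (Nat.one_le_iff_ne_zero.mpr hc0) hc4 h3c h27'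
  norm_num
  exact h9

end Summit.BirchSwinnertonDyer.Rank1Residual.GaloisImage.LocalTorsionExp3

end
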